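import Summits.BirchSwinnertonDyer.Rank1Residual.X2.ClassClosurePeriodFree
import Literature.NumberTheory.EllipticCurves.ModularParametrizationBCDTProofs
import Literature.NumberTheory.EllipticCurves.AnalyticRankModularityProofs
import HarnessLib

/-!
# The X2a closure term and the X2 class theorem WITHOUT the binder `hmod : hasEntireLFunction_rat`
# (cell `b2b-bsdres`, unit `b2b-bsdres-eisenstein-p2`, gen 29)

HONEST FRAMING (run/shared/lean/b2b/bsd-rank1-residual/, verbatim in every file): the goal of the
cell is to DELETE the COMBINATION-SHAPED residual classes of the Birch–Swinnerton-Dyer formula for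
ALL analytic-rank `≤ 1` elliptic curves over `ℚ` — "full BSD formula for every rank `≤ 1` curve in
class `C`" assembled STRICTLY from published theorems — so that the rank-`≤ 1` remainder becomes
exactly the CONSTRUCTION-SHAPED classes, which are TYPED (missing-input `Prop`s), NOT attempted.
This is not "finishing BSD". Research route; NO CLAIM BEYOND STATED CLASSES; nothing here changes
a label. Theorems only; no definition, no named fact.

WHAT. Every X2 closing form of record (gen 28: `GreenbergVatsalCaseTwoPeriodFree.targetA_periodFree_heightFree`,
SIXTEEN registered-fact binders; `ClassClosurePeriodFree.target_periodFree_of_residues`,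
`….bsdp_of_classX2_of_gvPar_periodFree`) binds BOTH `hmod : hasEntireLFunction_rat` ("`L(E, s)` is
entire for every `E/ℚ`", registry A19) AND `hpar : nonempty_modularParametrizationData` (a modular
parametrisation `X₀(N_E) → E` with its Manin datum exists for every `E/ℚ`). The second implies the
first BY THEOREMS OF THE TREE:

* `Literature.NumberTheory.EllipticCurves.ModularForms.exists_isNewformOf_of_nonempty_modularParametrizationData`
  (`ModularParametrizationBCDTProofs`: a parametrisation datum carries its newform `f` with
  `aₙ(f) = aₙ(E)`; transport along the global minimal model, `conductorNorm_int_smul`), and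
* `WeierstrassCurve.hasEntireLFunction_rat_of_exists_isNewformOf` (`AnalyticRankModularityProofs`:
  Diamond–Shurman Thm. 5.10.2, the analytic continuation of `L(s, f)`, "now applies to `L(s, E)`",
  Thm. 8.8.3 — the tree's `hasEntireLFunction_of_cuspCoeff_eq`).

This file composes them (`hasEntireLFunction_rat_of_nonempty_modularParametrizationData`) and
re-threads the three gen-28 terms WITHOUT `hmod`:

* **`targetA_entireFree_heightFree : X2.TargetA` from FIFTEEN registered facts** {T-GV23L `h23`,
  A137′ `hInf`, A40/A41 `hT`/`hT'`, A135 `hB`, A195 `hLiftF`, A226 `h311`, A224/A225 `hC`/`hD`,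
  A33 `hWu`, Stein–Wuthrich Thm. 6.1 `hJs`/`hJn`, `hGZK`, `hpar`, `hGS`};
* `targetB_of_missingInputB_entireFree` (X2b modulo its typed residue, no `hmod`);
* `target_entireFree_of_residues` (the class theorem of record modulo the named X2b/X2c residues);
* `bsdp_of_classX2_of_gvPar_entireFree` (`BSD(E,p)` per GV-parity pair, residues only at rank one).

Nothing mathematical is new: the binder `hmod` was redundant given `hpar` since the two Literature
theorems landed; this file only records the fact for the X2 terms (X2-LEDGER §2: the row
"`hmod`, `hpar` — A19 + parametrisation" becomes "`hpar`"; every closing form of the cell that binds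
both may drop `hmod` the same way).

References: [BCDTJAMS2001] Thm. A; [DiamondShurman2005] Thm. 5.10.2, Thm. 8.8.3;
[GreenbergVatsal2000] Thm. (1.3), §2 p. 28, §3 Thm. (3.11); [Wuthrich2014] Thm. 16;
[SteinWuthrich2013] Thm. 6.1, §4.2; [Disegni2020] Thm. 4; HOME/b2b-bsdres-eisenstein-p2/X2-GAP.md §34.
-/

set_option autoImplicit false

noncomputable section

open scoped Classical AddSubgroup MatrixGroups ModularForm

open PowerSeries NumberField IsDedekindDomain Field WeierstrassCurve CongruenceSubgroup
  Literature.NumberTheory.EllipticCurves Literature.NumberTheory.EllipticCurves.GreenbergVatsal2000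
  Literature.NumberTheory.EllipticCurves.ModularForms
  Literature.NumberTheory.EllipticCurves.Rank1Residual
  Literature.NumberTheory.EllipticCurves.Rank1Residual.Typed
  Literature.NumberTheory.EllipticCurves.Greenberg1999
  Literature.NumberTheory.EllipticCurves.Wuthrich2014
  Literature.NumberTheory.EllipticCurves.SteinWuthrich2013
  Literature.NumberTheory.EllipticCurves.Disegni2020
  Summit.BirchSwinnertonDyer.Rank1Residual.X2.GreenbergVatsalInputsOfFacts
  Summit.BirchSwinnertonDyer.Rank1Residual.X2.GreenbergVatsalCaseTwoPeriodFree
  Summit.BirchSwinnertonDyer.Rank1Residual.X2.ClassClosurePeriodFree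

namespace Summit.BirchSwinnertonDyer.Rank1Residual.X2.ClassClosureEntireFree

/-! ## §1. `hpar ⇒ hmod` by theorems of the tree -/

/-- **Modularity Theorem in the parametrisation form ⇒ `L(E, s)` entire for every `E/ℚ`**, composed
from two theorems of the tree: a modular parametrisation datum for every (globally minimal) `E/ℚ`
gives a newform `f ∈ S₂(Γ₀(N_E))` with `aₙ(f) = aₙ(E)` for every `E/ℚ`
(`exists_isNewformOf_of_nonempty_modularParametrizationData`), and then `L(E, s) = L(f, s)` is entire
by Hecke / Diamond–Shurman Thm. 5.10.2 (`hasEntireLFunction_rat_of_exists_isNewformOf`). Hence the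
binder `hmod : hasEntireLFunction_rat` of the cell's closing forms is REDUNDANT given
`hpar : nonempty_modularParametrizationData`. [cite: BCDTJAMS2001, Theorem A]
[cite: DiamondShurman2005, Thm. 8.8.3 and Thm. 5.10.2] -/
theorem hasEntireLFunction_rat_of_nonempty_modularParametrizationData
    (hpar : nonempty_modularParametrizationData) : hasEntireLFunction_rat :=
  hasEntireLFunction_rat_of_exists_isNewformOf
    (exists_isNewformOf_of_nonempty_modularParametrizationData hpar)

/-! ## §2. The X2a closure term from FIFTEEN registered facts -/

/-- **`X2.TargetA` (the X2a closure of record: `BSD(E,p)` at every pair with `r_an = 0`, `p` odd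
multiplicative, GV parity) from FIFTEEN registered facts** — gen 28's
`GreenbergVatsalCaseTwoPeriodFree.targetA_periodFree_heightFree` (sixteen) with the binder
`hmod : hasEntireLFunction_rat` DISCHARGED from `hpar` by §1. Registered inputs: T-GV23L `h23` ·
A137′ `hInf` · A40/A41 `hT`/`hT'` · A135 `hB` · A195 `hLiftF` · A226 `h311` · A224/A225 `hC`/`hD` ·
A33 `hWu` · Stein–Wuthrich Thm. 6.1 `hJs`/`hJn` · `hGZK` · `hpar` · `hGS`.
[cite: GreenbergVatsal2000, Thm. (1.3) with pp. 1, 14–15, §2 pp. 28–30, §3 Thm. (3.11), pp. 41–43]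
[cite: Wuthrich2014, Thm. 16 (p. 397)] [cite: SteinWuthrich2013, Thm. 6.1 (p. 20), §4.2]
[cite: BCDTJAMS2001, Theorem A] -/
theorem targetA_entireFree_heightFree
    (h23 : datumSelmer_nonPrimitive_invariants)
    (hInf : datumStrictSelmer_relIndex_eq_zero_of_split)
    (hT : Silverman1994_thmV53_tateUniformisation.{0})
    (hT' : Silverman1994_thmV53_corV54_tateUniformisation.{0})
    (hB : datumSelmer_divisible_of_finite_torsionBy)
    (hLiftF : residualEpsilon_surjOn_of_lineRamifiedEven)
    (h311 : thm311_hasUnitContent_iff_and_order_eq_of_lineRamifiedEven)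
    (hC : characterLFunctionC_hasUnitContent_and_order_eq_card)
    (hD : characterLFunctionD_hasUnitContent_and_order_eq_card)
    (hWu : thm16_charIdeal_dvd_multiplicative_of_reducible)
    (hJs : thm61_splitMultiplicative) (hJn : thm61_nonsplitMultiplicative)
    (hGZK : rank_eq_analyticRank_of_analyticRank_le_one)
    (hpar : nonempty_modularParametrizationData)
    (hGS : ∀ (W : WeierstrassCurve ℚ) [W.IsElliptic] [W.IsGloballyMinimal] (p : ℕ) [Fact p.Prime],
      greenberg_stevens (W := W) (p := p)) :
    TargetA :=
  targetA_periodFree_heightFree h23 hInf hT hT' hB hLiftF h311 hC hD hWu hJs hJn hGZK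
    (hasEntireLFunction_rat_of_nonempty_modularParametrizationData hpar) hpar hGS

/-- **Mazur's main conjecture ⇒ `BSD(E,p)` at every X2b pair WITHOUT `hmod`** — the X2b term of
record `targetB_of_missingInputB` (its residue `hResB` = Mazur's main conjecture at the pair, `μ > 0`
allowed) with `hmod` discharged from `hpar` by §1.
[cite: SteinWuthrich2013, Thm. 6.1 (p. 20)] [cite: BCDTJAMS2001, Theorem A] -/
theorem targetB_of_missingInputB_entireFree
    (hJs : thm61_splitMultiplicative) (hJn : thm61_nonsplitMultiplicative)
    (hHs : exists_isSplitMultCanonical) (hHn : exists_isMultCanonical)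
    (hGZK : rank_eq_analyticRank_of_analyticRank_le_one)
    (hpar : nonempty_modularParametrizationData)
    (hGS : ∀ (W : WeierstrassCurve ℚ) [W.IsElliptic] [W.IsGloballyMinimal] (p : ℕ) [Fact p.Prime],
      greenberg_stevens (W := W) (p := p))
    (hResB : ∀ (W : WeierstrassCurve ℚ) [W.IsElliptic] [W.IsGloballyMinimal] (p : ℕ) [Fact p.Prime],
      CellB W p → MazurMainConjectureAt W p) :
    TargetB :=
  targetB_of_missingInputB hJs hJn hHs hHn hGZK
    (hasEntireLFunction_rat_of_nonempty_modularParametrizationData hpar) hpar hGS hResB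

/-! ## §3. The class theorem of record modulo the named residues, and `BSD(E,p)` per GV-parity pair -/

/-- **THE CLASS THEOREM OF RECORD MODULO NAMED RESIDUES, without `hmod`** — gen 28's
`ClassClosurePeriodFree.target_periodFree_of_residues` with `hmod : hasEntireLFunction_rat`
DISCHARGED from `hpar` by §1; class-level registered inputs T-GV23L `h23`, A137′ `hInf`, A40/A41
`hT`/`hT'`, A135 `hB`, A195 `hLiftF`, A226 `h311`, A224/A225 `hC`/`hD`, A33 `hWu` + the rank-`≤ 1`
assembly facts; per-pair residues exactly as before (`hResB`, `hResCns`, `hResCs`).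
[cite: GreenbergVatsal2000, Thm. (1.3), §1 pp. 14–15, §2 pp. 28–30, §3 Thm. (3.11), (26)–(28), pp. 41–43]
[cite: Wuthrich2014, Thm. 16 (p. 397)] [cite: Disegni2020, Thm. 4 (§3.2)]
[cite: SteinWuthrich2013, Thm. 6.1 (p. 20) and §4.2] [cite: BCDTJAMS2001, Theorem A] -/
theorem target_entireFree_of_residues
    (h23 : datumSelmer_nonPrimitive_invariants)
    (hInf : datumStrictSelmer_relIndex_eq_zero_of_split)
    (hT : Silverman1994_thmV53_tateUniformisation.{0})
    (hT' : Silverman1994_thmV53_corV54_tateUniformisation.{0})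
    (hB : datumSelmer_divisible_of_finite_torsionBy)
    (hLiftF : residualEpsilon_surjOn_of_lineRamifiedEven)
    (h311 : thm311_hasUnitContent_iff_and_order_eq_of_lineRamifiedEven)
    (hC : characterLFunctionC_hasUnitContent_and_order_eq_card)
    (hD : characterLFunctionD_hasUnitContent_and_order_eq_card)
    (hWu : thm16_charIdeal_dvd_multiplicative_of_reducible)
    (hJs : thm61_splitMultiplicative) (hJn : thm61_nonsplitMultiplicative)
    (hHs : exists_isSplitMultCanonical) (hHn : exists_isMultCanonical)
    (hGZ : GrossZagier1986_thm_I_7_3) (hGZK : rank_eq_analyticRank_of_analyticRank_le_one)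
    (hpar : nonempty_modularParametrizationData)
    (hGS : ∀ (W : WeierstrassCurve ℚ) [W.IsElliptic] [W.IsGloballyMinimal] (p : ℕ) [Fact p.Prime],
      greenberg_stevens (W := W) (p := p))
    (hDis : padicBSD_rankOne_nonsplitMult)
    (hResB : ∀ (W : WeierstrassCurve ℚ) [W.IsElliptic] [W.IsGloballyMinimal] (p : ℕ) [Fact p.Prime],
      CellB W p → MazurMainConjectureAt W p)
    (hResCns : ∀ (W : WeierstrassCurve ℚ) [W.IsElliptic] [W.IsGloballyMinimal] (p : ℕ) [Fact p.Prime],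
      CellC W p → ¬ W.HasSplitMultiplicativeReductionAtPrime p →
        (GVPar W p ∨ MazurMainConjectureAt W p) ∧
        ∀ (q : ℚ_[p]) (Dh : PAdicHeightData W p), q ≠ 0 → ‖q‖ < 1 → tateJ q = (W.j : ℚ_[p]) →
          IsMultCanonical Dh q → SchneiderConjecture Dh)
    (hResCs : ∀ (W : WeierstrassCurve ℚ) [W.IsElliptic] [W.IsGloballyMinimal] (p : ℕ) [Fact p.Prime],
      CellC W p → W.HasSplitMultiplicativeReductionAtPrime p →
        (GVPar W p ∨ MazurMainConjectureAt W p) ∧ O9.ExceptionalLeadingTermAt W p ∧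
        ∀ (Dq : TateParameterData W p) (Dh : PAdicHeightData W p),
          IsSplitMultCanonical Dh Dq → SchneiderConjecture Dh) :
    Target :=
  target_periodFree_of_residues h23 hInf hT hT' hB hLiftF h311 hC hD hWu hJs hJn hHs hHn hGZ hGZK
    (hasEntireLFunction_rat_of_nonempty_modularParametrizationData hpar) hpar hGS hDis hResB hResCns
    hResCs

/-- **X2 WITHOUT residues on its GV-parity part, without `hmod`**: on every X2 pair with `GVPar`,
`BSD(E,p)` holds at `r_an = 0` outright and at `r_an = 1` modulo the Schneider certificate
(non-split) / the certificate and the typed exceptional leading term (split) — gen 28's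
`bsdp_of_classX2_of_gvPar_periodFree` with `hmod` discharged from `hpar` by §1.
[cite: GreenbergVatsal2000, Thm. (1.3) with §2 pp. 28–30, §3 Thm. (3.11)]
[cite: Disegni2020, Thm. 4 (§3.2)] [cite: Wuthrich2014, Thm. 16 (p. 397)]
[cite: BCDTJAMS2001, Theorem A] -/
theorem bsdp_of_classX2_of_gvPar_entireFree
    (h23 : datumSelmer_nonPrimitive_invariants)
    (hInf : datumStrictSelmer_relIndex_eq_zero_of_split)
    (hT : Silverman1994_thmV53_tateUniformisation.{0})
    (hT' : Silverman1994_thmV53_corV54_tateUniformisation.{0})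
    (hB : datumSelmer_divisible_of_finite_torsionBy)
    (hLiftF : residualEpsilon_surjOn_of_lineRamifiedEven)
    (h311 : thm311_hasUnitContent_iff_and_order_eq_of_lineRamifiedEven)
    (hC : characterLFunctionC_hasUnitContent_and_order_eq_card)
    (hD : characterLFunctionD_hasUnitContent_and_order_eq_card)
    (hWu : thm16_charIdeal_dvd_multiplicative_of_reducible)
    (hJs : thm61_splitMultiplicative) (hJn : thm61_nonsplitMultiplicative)
    (hHs : exists_isSplitMultCanonical) (hHn : exists_isMultCanonical)
    (hGZ : GrossZagier1986_thm_I_7_3) (hGZK : rank_eq_analyticRank_of_analyticRank_le_one)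
    (hpar : nonempty_modularParametrizationData)
    (W : WeierstrassCurve ℚ) [W.IsElliptic] [W.IsGloballyMinimal] (p : ℕ) [Fact p.Prime]
    (hGS : greenberg_stevens (W := W) (p := p)) (hDis : padicBSD_rankOne_nonsplitMult)
    (hr : W.analyticRank ≤ 1) (hX : ClassX2 W p) (hgv : GVPar W p)
    (hSchNs : W.analyticRank = 1 → ¬ W.HasSplitMultiplicativeReductionAtPrime p →
      ∀ (q : ℚ_[p]) (Dh : PAdicHeightData W p), q ≠ 0 → ‖q‖ < 1 → tateJ q = (W.j : ℚ_[p]) →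
        IsMultCanonical Dh q → SchneiderConjecture Dh)
    (hExcS : W.analyticRank = 1 → W.HasSplitMultiplicativeReductionAtPrime p →
      O9.ExceptionalLeadingTermAt W p ∧
      ∀ (Dq : TateParameterData W p) (Dh : PAdicHeightData W p),
        IsSplitMultCanonical Dh Dq → SchneiderConjecture Dh) :
    BSDp W p :=
  bsdp_of_classX2_of_gvPar_periodFree h23 hInf hT hT' hB hLiftF h311 hC hD hWu hJs hJn hHs hHn hGZ hGZK
    (hasEntireLFunction_rat_of_nonempty_modularParametrizationData hpar) hpar W p hGS hDis hr hX hgv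
    hSchNs hExcS

end Summit.BirchSwinnertonDyer.Rank1Residual.X2.ClassClosureEntireFree

end
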